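import Literature.MathematicalPhysics.QuantumFieldTheory.Balaban1983to89.B9Eq368RLipschitzTowerTwoBackgrounds
import Literature.MathematicalPhysics.QuantumFieldTheory.Balaban1983to89.B9Eq315QTowerFlat

/-!
# `Balaban1983to89.B9Eq368RLipschitzTowerFlat` — T. Bałaban, *Propagators for lattice gauge theories in a background field*, Commun. Math. Phys.
# **99** (1985) 389–434 [Balaban1985BackgroundPropagators] (3.68) p. 404 with (3.25)–(3.26) p. 395 and (3.15) p. 393: AT `k` LEVELS AND A FIXED LATTICE,
# PRINT's PROJECTION `R_k(U)` ONTO `Δ_U N(Q′_k(U))` IS `O(ε̄)`-CLOSE TO THE FLAT ONE `R_k(1)` ON THE SMALL FIELDS — `‖R_k(U)z − R_k(1)z‖ ≤ C_R·ε̄·‖z‖`: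
# the one-background reading (`U′ := 1`) of this lineage's two-background tower letter `B9Eq368RLipschitzTowerTwoBackgrounds.exists_RofUk_sub_RofUk_linear`
# — the `R`-slot (`hR : ‖(R_{n+1}(U) − R_{n+1}(1))y‖ ≤ C_R·ε̄·‖y‖`) displayed by the NE9 owner's k-level scaled small-field coercivity
# (`B9Thm311SmallFieldCoercivityTowerScaled`, t4-ne9-p1 gen 84 INTENT-5; WANTED (R-flat-k), journal `CLAIMS.log` l.46532)

statement-level skeleton of published theorems with citation tags; proofs where landed; nothing here is a claim about the Yang–Mills mass gap

PDF held: `paper:balaban1985-cmp99-background-propagators` (journal page = PDF page + 388); pp. 395, 404 through the verbatim quotations of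
`B9Eq368RLipschitz` (NE9 owner gen 81) and `B9Eq368RLipschitzTowerTwoBackgrounds` (this lineage gen 74).

CITATION HEADER (lean-in-tree rule 2026-08-18).  Audit cell `pub-balaban`, sub-cell `t4`, NE9 crux team (2): LEAF PROVER 04
(`b2b-balaban-t4-ne9-formalise-leaf-04` gen 74) — TOWER-SPECIES-PLAN §2 (e); a corollary asked for by the row owner (W-7 l.46532).

THE PRINT (as quoted in `B9Eq368RLipschitz`).  p. 404, (3.68): *«R(U) the orthogonal projection onto Δ_U N(Q′(U))»*; p. 395, (3.25)–(3.26): the gauge-fixed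
operator `Δ_a(U) = Δ(U) + DR(U)D* + aQ*(U)Q(U)` with print's `k`-level composite `Q` of (3.15) and `Q′` of (3.19).

WHAT IS PROVED (sorry-free; no `Prop` placeholder; no inequality of the paper asserted).
* **`exists_RofUk_sub_flat_linear`** — `∃ C_R ε_R > 0 ∀ U : Bond d (towerP L m (n+1)) → 𝔸ˣ` with `U(b) ∈ U1`, `‖U(b) − 1‖ ≤ ε̄ ≤ ε_R`, `hRS`, and the level
  letters `UlevOf L m (n+1) U j b ∈ U1`, `‖UlevOf L m (n+1) U j b − 1‖ ≤ ε̄` (DISPLAYED, as everywhere in the chain): `∀ z`,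
  `‖RofUk L m n φ η U z − RofUk L m n φ η 1 z‖ ≤ C_R·ε̄·‖z‖` — `exists_RofUk_sub_RofUk_linear` at `U′ := 1`, `δ := ε̄`: the flat background's bonds
  are `1 ∈ U1` at distance `0 ≤ ε̄` from `1` and `ε̄` from `U`, its transport is self-adjoint (`hRS_one`), its level averages are `1`
  (`B9Eq315QTowerFlat.UlevOf_one`).  SAME constants `C_R = 64|η|⁻²dK_R(1 + 2C_SC_ρ)∕μ + 1`, `ε_R` as the two-background letter (honest: `η`-, `μ`-,
  volume- and level-number-dependent, per lattice).
MODEL / HONEST SCOPE.  [folklore] specialisation of a landed letter; finite lattice, fixed number of levels; NOT print's analytic `R(U′U)`, NOT uniformity;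
NOT summit progress (cell pub-balaban: NE9 NOT PRINTED ∕ NOT PROVED; spine PROVED 0∕9; rung (B)+1 finite T⁴ — NOT infinite volume, NOT mass gap, NOT
BetaPertH, NOT Clay).  NEW file importing `B9Eq368RLipschitzTowerTwoBackgrounds` + `B9Eq315QTowerFlat`; nothing else modified.  Net new unproved facts: 0.
-/

noncomputable section

open scoped InnerProductSpace ComplexConjugate

namespace Literature.MathematicalPhysics.QuantumFieldTheory.Balaban1983to89.B9Eq368RLipschitzTowerFlat

open B9SectCLatticeCarrier (Bond)
open B7Prop1Explicit (U1)
open B11Eq103H1Complex (SiteL2K)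
open B9Eq310HessianOperator (adTransportW)
open B9Eq315QTower (towerP UlevOf)
open B9Eq315QTowerFlat (UlevOf_one)
open B9Eq326OperatorTower (RofUk)
open B9Eq384RemainderLetters (hRS_one)
open B9Eq368RLipschitzTowerTwoBackgrounds (exists_RofUk_sub_RofUk_linear)

variable {d : ℕ} (L : ℕ) [NeZero L] (m : Fin d → ℕ) [∀ i, NeZero (m i)] (n : ℕ)
  {𝔸 : Type*} [NormedRing 𝔸] [NormedAlgebra ℂ 𝔸] [CompleteSpace 𝔸] [NormOneClass 𝔸]
  {W : Type*} [NormedAddCommGroup W] [InnerProductSpace ℂ W] [FiniteDimensional ℂ W] (φ : W ≃ₗ[ℂ] 𝔸) {c₀ : ℝ} [Fact (0 < c₀)]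

/-- **`‖R_k(U)z − R_k(1)z‖ ≤ C_R·ε̄·‖z‖` ON THE SMALL FIELDS OF A FIXED LATTICE** (bonds and level averages `U1`-valued and `ε̄`-close to `1`,
`ε̄ ≤ ε_R`, `hRS`): the two-background tower letter `exists_RofUk_sub_RofUk_linear` read at `U′ := 1`, `δ := ε̄` — the `R`-slot of the owner's
k-level scaled small-field coercivity. [cite: Balaban1985BackgroundPropagators, (3.68) p.404, (3.25)–(3.26) p.395, (3.15) p.393] -/
theorem exists_RofUk_sub_flat_linear {η : ℝ} (hη : η ≠ 0) {Mφ Mφ' : ℝ} (hMφ : 0 ≤ Mφ) (hMφ' : 0 ≤ Mφ')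
    (hφ : ∀ w, ‖φ w‖ ≤ Mφ * ‖w‖) (hφ' : ∀ X, ‖φ.symm X‖ ≤ Mφ' * ‖X‖) :
    ∃ CR εR : ℝ, 0 < CR ∧ 0 < εR ∧ ∀ (U : Bond d (towerP L m (n + 1)) → 𝔸ˣ) {ε : ℝ}, 0 ≤ ε → ε ≤ εR →
      (∀ b, U b ∈ U1 𝔸) → (∀ b, ‖(U b : 𝔸) - 1‖ ≤ ε) →
      (∀ (b : Bond d (towerP L m (n + 1))) (v u : W), ⟪adTransportW φ U b v, u⟫_ℂ = ⟪v, adTransportW φ (fun b => (U b)⁻¹) b u⟫_ℂ) →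
      (∀ (j : ℕ) (b : Bond d (towerP L m (j + 1))), UlevOf L m (n + 1) U j b ∈ U1 𝔸) →
      (∀ (j : ℕ) (b : Bond d (towerP L m (j + 1))), ‖((UlevOf L m (n + 1) U j b : 𝔸ˣ) : 𝔸) - 1‖ ≤ ε) →
      ∀ z : SiteL2K ℂ d (towerP L m (n + 1)) c₀ W,
        ‖RofUk L m n φ η U z - RofUk L m n φ η (fun _ : Bond d (towerP L m (n + 1)) => (1 : 𝔸ˣ)) z‖ ≤ CR * ε * ‖z‖ := by
  obtain ⟨CR, εR, hCR, hεR, H⟩ := exists_RofUk_sub_RofUk_linear L m n φ (c₀ := c₀) hη hMφ hMφ' hφ hφ'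
  refine ⟨CR, εR, hCR, hεR, fun U ε hε hεR hUb hUε hRS hLb hLε z => ?_⟩
  -- the flat background's letters: bonds `1 ∈ U1`, `‖1 − 1‖ = 0`, `‖U(b) − 1‖ ≤ ε̄`, self-adjoint transport, level averages `= 1`
  have h1b : ∀ b : Bond d (towerP L m (n + 1)), (fun _ : Bond d (towerP L m (n + 1)) => (1 : 𝔸ˣ)) b ∈ U1 𝔸 := fun _ => one_mem _
  have h1ε : ∀ b : Bond d (towerP L m (n + 1)), ‖(((fun _ : Bond d (towerP L m (n + 1)) => (1 : 𝔸ˣ)) b : 𝔸ˣ) : 𝔸) - 1‖ ≤ ε := fun _ => by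
    rw [Units.val_one, sub_self, norm_zero]; exact hε
  have hU1ε : ∀ b : Bond d (towerP L m (n + 1)), ‖(U b : 𝔸) - (((fun _ : Bond d (towerP L m (n + 1)) => (1 : 𝔸ˣ)) b : 𝔸ˣ) : 𝔸)‖ ≤ ε :=
    fun b => by rw [Units.val_one]; exact hUε b
  have hRS1 : ∀ (b : Bond d (towerP L m (n + 1))) (v u : W), ⟪adTransportW φ (fun _ : Bond d (towerP L m (n + 1)) => (1 : 𝔸ˣ)) b v, u⟫_ℂ =
      ⟪v, adTransportW φ (fun b => ((fun _ : Bond d (towerP L m (n + 1)) => (1 : 𝔸ˣ)) b)⁻¹) b u⟫_ℂ := fun b v u => hRS_one L (towerP L m n) φ b v u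
  have hL1b : ∀ (j : ℕ) (b : Bond d (towerP L m (j + 1))), UlevOf L m (n + 1) (fun _ : Bond d (towerP L m (n + 1)) => (1 : 𝔸ˣ)) j b ∈ U1 𝔸 :=
    fun j b => by rw [UlevOf_one]; exact one_mem _
  have hL1ε : ∀ (j : ℕ) (b : Bond d (towerP L m (j + 1))), ‖((UlevOf L m (n + 1) (fun _ : Bond d (towerP L m (n + 1)) => (1 : 𝔸ˣ)) j b : 𝔸ˣ) : 𝔸) - 1‖ ≤ ε :=
    fun j b => by rw [UlevOf_one, Units.val_one, sub_self, norm_zero]; exact hε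
  have hLL1 : ∀ (j : ℕ) (b : Bond d (towerP L m (j + 1))),
      ‖((UlevOf L m (n + 1) U j b : 𝔸ˣ) : 𝔸) - ((UlevOf L m (n + 1) (fun _ : Bond d (towerP L m (n + 1)) => (1 : 𝔸ˣ)) j b : 𝔸ˣ) : 𝔸)‖ ≤ ε :=
    fun j b => by rw [UlevOf_one, Units.val_one]; exact hLε j b
  exact H U (fun _ => 1) hε hεR hε hUb h1b hUε h1ε hU1ε hRS hRS1 hLb hL1b hLε hL1ε hLL1 z

end Literature.MathematicalPhysics.QuantumFieldTheory.Balaban1983to89.B9Eq368RLipschitzTowerFlat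

end
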